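import Literature.NumberTheory.PAdicHodge.UnramifiedWittFixedFrobenius
import Mathlib.FieldTheory.Finite.Basic
import HarnessLib

/-!
# The residue field `k_F` inside `k̄`, and the roots of `X^{q_F} − X` in `k̄` and in `ℂ_F`

Topic `Literature/NumberTheory/PAdicHodge`; second instalment of the classification of the `ℚ_p`-embeddings
of a `p`-adic field `F` restricted to `W(k_F)` (solo-Langlands-informed Stage E2.9c, memo `work/s113/E29.md` §5).
Let `k̄ = ResidueField (maxUnramifiedCompletion F)` (the residue field of `𝒪̂_{F^nr}`, algebraically closed),
`Γ_F` acting on it by `residueGal`, and `q = q_F = #k_F`.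

* §1 **`k_F ↪ k̄`** (`residueFieldEmb F : 𝓀[F] →+* k̄`, induced by `𝒪_F → 𝒪̂_{F^nr}`): its image is pointwise
  fixed by `Γ_F` (`residueGal_residueFieldEmb`) and conversely **every `Γ_F`-fixed element of `k̄` lies in the
  image** (`exists_residueFieldEmb_eq_of_fixed`; the tree's `IsAbsArithFrob.exists_sub_algebraMap_mem_maximalIdeal`,
  Serre IV §4 Cor. 2), so `k̄^{Γ_F} = k_F`; `x ^ q = x` on `k_F` (`pow_residueFieldCard`).
* §2 **The roots of `X^q − X` in `k̄` are exactly `k_F`** (`exists_residueFieldEmb_eq_of_pow_eq`: `q` distinct roots of a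
  degree-`q` polynomial over a field, `exists_eq_of_pow_eq_of_injective`), hence `Γ_F`-fixed (`residueGal_eq_self_of_pow_eq`);
  `char k_F = p` and `q = p^f` when `|p|_F < 1` (`charP_residueField`, `exists_residueFieldCard_eq_pow`).
* §3 Teichmüller lifts `[b] ∈ W(k̄)`, `b ∈ k̄`, have **distinct images in `ℂ_F`** unless equal — indeed
  `‖wittToC [b] − wittToC [b']‖ < 1 ⇒ b = b'` (`teichmuller_eq_of_norm_wittToC_sub_lt_one`: an element of
  `𝒪̂_{F^nr}` of absolute value `< 1` in `ℂ_F` is in `𝔪̂`, `mem_maximalIdeal_of_norm_toC_lt_one`); so **the roots of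
  `X^q − X` in `ℂ_F` are exactly the `q` elements `wittToC [ι x]`, `x ∈ k_F`** (`exists_eq_wittToC_teichmuller_of_pow_eq`).

Definition (reviewed): `residueFieldEmb`. No named facts, no instances, no `sorry`.

## References
* J.-P. Serre, *Local Fields* (GTM 67, 1979), Ch. II §4 Prop. 8, §5 Thm. 3–4, Ch. IV §4 Cor. 2 to Prop. 16. [SerreLocalFields1979]
* J.-M. Fontaine, *Le corps des périodes p-adiques*, Astérisque 223 (1994), Exp. II §1.2. [FontaineAsterisque223III]
-/

noncomputable section

open IsLocalRing WittVector Polynomial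

namespace Literature.NumberTheory.PAdicHodge

open Literature.NumberTheory.GaloisRepresentations
open Literature.NumberTheory.GaloisRepresentations.IsNonarchimedeanLocalField
open Field ValuativeRel

variable {F : Type} [Field F] [ValuativeRel F] [TopologicalSpace F] [IsNonarchimedeanLocalField F] [CharZero F]
  {p : ℕ} [Fact p.Prime]

/-! ## §1 `k_F ↪ k̄ = 𝒪̂_{F^nr}/𝔪̂` and `k̄^{Γ_F} = k_F` -/

omit [CharZero F] in
/-- An element of `𝒪_F` whose image in `k̄` is non-zero is a unit (`𝔪̂ ∩ 𝒪_F = 𝔪_F`).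
[cite: SerreLocalFields1979, Ch. IV §4 Prop. 16] -/
theorem isUnit_of_residue_algebraMap_ne_zero {a : 𝒪[F]}
    (h : IsLocalRing.residue (maxUnramifiedCompletion F) (algebraMap 𝒪[F] (maxUnramifiedCompletion F) a) ≠ 0) :
    IsUnit a := by
  by_contra ha
  apply h
  rw [IsLocalRing.residue_eq_zero_iff]
  have h1 : a ∈ 𝓂[F] := (IsLocalRing.mem_maximalIdeal a).2 ha
  have h2 := (maxUnramifiedCompletion.algebraMap_mem_maximalIdeal_pow_iff (F := F) 1 a).2 (by rw [pow_one]; exact h1)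
  rwa [pow_one] at h2

variable (F) in
/-- **`k_F ↪ k̄`**: the embedding of the residue field of `F` into the residue field of `𝒪̂_{F^nr}` induced by
`𝒪_F → 𝒪̂_{F^nr}` (a local homomorphism). [cite: SerreLocalFields1979, Ch. II §5 Thm. 3] -/
def residueFieldEmb : 𝓀[F] →+* ResidueField (maxUnramifiedCompletion F) :=
  haveI : IsLocalHom ((IsLocalRing.residue (maxUnramifiedCompletion F)).comp
      (algebraMap 𝒪[F] (maxUnramifiedCompletion F))) :=
    ⟨fun _ ha => isUnit_of_residue_algebraMap_ne_zero (F := F) ha.ne_zero⟩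
  IsLocalRing.ResidueField.lift ((IsLocalRing.residue (maxUnramifiedCompletion F)).comp
    (algebraMap 𝒪[F] (maxUnramifiedCompletion F)))

omit [CharZero F] in
/-- Unfolding `k_F ↪ k̄` on residues. [cite: SerreLocalFields1979, Ch. II §5 Thm. 3] -/
theorem residueFieldEmb_residue (a : 𝒪[F]) :
    residueFieldEmb F (IsLocalRing.residue 𝒪[F] a) =
      IsLocalRing.residue (maxUnramifiedCompletion F) (algebraMap 𝒪[F] (maxUnramifiedCompletion F) a) := rfl

omit [CharZero F] in
/-- `k_F ↪ k̄` is injective. [cite: SerreLocalFields1979, Ch. II §5 Thm. 3] -/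
theorem residueFieldEmb_injective : Function.Injective (residueFieldEmb F) := (residueFieldEmb F).injective

omit [CharZero F] in
/-- **`Γ_F` fixes `k_F ⊆ k̄` pointwise** (it fixes `𝒪_F ⊆ 𝒪̂_{F^nr}`). [cite: SerreLocalFields1979, Ch. II §5 Thm. 3] -/
theorem residueGal_residueFieldEmb (σ : absoluteGaloisGroup F) (x : 𝓀[F]) :
    residueGal σ (residueFieldEmb F x) = residueFieldEmb F x := by
  obtain ⟨a, rfl⟩ := IsLocalRing.residue_surjective x
  rw [residueFieldEmb_residue, residueGal_residue, maxUnramifiedCompletion.galAut_algebraMap]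

omit [CharZero F] in
/-- **`k̄^{Γ_F} ⊆ k_F`**: a `Γ_F`-fixed element of `k̄` comes from `k_F` (an arithmetic Frobenius already forces it:
tree `IsAbsArithFrob.exists_sub_algebraMap_mem_maximalIdeal`). [cite: SerreLocalFields1979, Ch. IV §4 Cor. 2 to Prop. 16] -/
theorem exists_residueFieldEmb_eq_of_fixed {b : ResidueField (maxUnramifiedCompletion F)}
    (hb : ∀ σ : absoluteGaloisGroup F, residueGal σ b = b) : ∃ x : 𝓀[F], residueFieldEmb F x = b := by
  obtain ⟨σ₀, hσ₀⟩ := exists_isAbsArithFrob_holds (F := F)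
  obtain ⟨d, rfl⟩ := IsLocalRing.residue_surjective b
  have hd : maxUnramifiedCompletion.galAut F σ₀ d - d ∈ maximalIdeal (maxUnramifiedCompletion F) := by
    rw [← IsLocalRing.residue_eq_zero_iff, map_sub, ← residueGal_residue, hb σ₀, sub_self]
  obtain ⟨e, he⟩ := IsAbsArithFrob.exists_sub_algebraMap_mem_maximalIdeal hσ₀ d hd
  refine ⟨IsLocalRing.residue 𝒪[F] e, ?_⟩
  rw [residueFieldEmb_residue]
  exact ((Ideal.Quotient.mk_eq_mk_iff_sub_mem _ _).2 he).symm

omit [CharZero F] in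
/-- The `Γ_F`-fixed elements of `k̄` are exactly the image of `k_F`. [cite: SerreLocalFields1979, Ch. IV §4 Cor. 2 to Prop. 16] -/
theorem fixed_iff_mem_range_residueFieldEmb (b : ResidueField (maxUnramifiedCompletion F)) :
    (∀ σ : absoluteGaloisGroup F, residueGal σ b = b) ↔ b ∈ Set.range (residueFieldEmb F) := by
  constructor
  · exact fun hb => exists_residueFieldEmb_eq_of_fixed hb
  · rintro ⟨x, rfl⟩ σ
    exact residueGal_residueFieldEmb σ x

omit [CharZero F] in
/-- `#k_F = q_F` as a `Fintype.card`. [cite: SerreLocalFields1979, Ch. II §4 Prop. 8] -/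
theorem card_residueField_eq [Fintype 𝓀[F]] : Fintype.card 𝓀[F] = residueFieldCard F := by
  rw [residueFieldCard, Nat.card_eq_fintype_card]

omit [CharZero F] in
/-- **`x ^ q_F = x` in `k_F`.** [cite: SerreLocalFields1979, Ch. II §4 Prop. 8] -/
theorem pow_residueFieldCard (x : 𝓀[F]) : x ^ residueFieldCard F = x := by
  classical
  letI := Fintype.ofFinite 𝓀[F]
  rw [← card_residueField_eq]
  exact FiniteField.pow_card x

omit [CharZero F] in
/-- `(ι x) ^ q_F = ι x` in `k̄` for `x ∈ k_F`. [cite: SerreLocalFields1979, Ch. II §4 Prop. 8] -/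
theorem residueFieldEmb_pow_residueFieldCard (x : 𝓀[F]) :
    residueFieldEmb F x ^ residueFieldCard F = residueFieldEmb F x := by
  rw [← map_pow, pow_residueFieldCard]

omit [CharZero F] in
/-- **`char k_F = p`** when `|p|_F < 1`. [cite: SerreLocalFields1979, Ch. II §5] -/
theorem charP_residueField (hp : valuation F p < 1) : CharP 𝓀[F] p := by
  have h0 : ((p : ℕ) : 𝓀[F]) = 0 := by
    rw [← map_natCast (IsLocalRing.residue 𝒪[F]), IsLocalRing.residue_eq_zero_iff]
    exact LocalField.natCast_mem_maximalIdeal hp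
  exact (CharP.charP_iff_prime_eq_zero (Fact.out : p.Prime)).mpr h0

omit [CharZero F] in
/-- `q_F = p ^ f` for some `f ≥ 1` when `|p|_F < 1`. [cite: SerreLocalFields1979, Ch. II §5] -/
theorem exists_residueFieldCard_eq_pow (hp : valuation F p < 1) : ∃ f : ℕ, 0 < f ∧ residueFieldCard F = p ^ f := by
  haveI := charP_residueField hp
  obtain ⟨f, hf, h⟩ := residueFieldCard_eq_pow_ringChar F
  exact ⟨f, hf, by rwa [ringChar.eq 𝓀[F] p] at h⟩

/-! ## §2 The roots of `X^{q_F} − X` in `k̄` -/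

omit [CharZero F] [Fact p.Prime] in
/-- Root counting: in a field, an injective family of `q` roots of `X^q − X` indexed by a type of cardinality `q`
exhausts the roots. [cite: SerreLocalFields1979, Ch. II §4 Prop. 8] -/
theorem exists_eq_of_pow_eq_of_injective {K ι : Type*} [Field K] [Fintype ι] {q : ℕ} (hq : 1 < q)
    (hcard : Fintype.card ι = q) (g : ι → K) (hg : Function.Injective g) (hroot : ∀ i, g i ^ q = g i)
    {r : K} (hr : r ^ q = r) : ∃ i, r = g i := by
  classical
  set P : K[X] := X ^ q - X with hP
  have hP0 : P ≠ 0 := FiniteField.X_pow_card_sub_X_ne_zero K hq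
  have hdeg : P.natDegree = q := FiniteField.X_pow_card_sub_X_natDegree_eq K hq
  have hmem : ∀ y : K, y ∈ P.roots.toFinset ↔ y ^ q = y := fun y => by
    rw [Multiset.mem_toFinset, mem_roots hP0, IsRoot, eval_sub, eval_pow, eval_X, sub_eq_zero]
  have hsub : Finset.univ.image g ⊆ P.roots.toFinset := by
    intro y hy
    obtain ⟨i, -, rfl⟩ := Finset.mem_image.1 hy
    exact (hmem _).2 (hroot i)
  have hcard' : P.roots.toFinset.card ≤ (Finset.univ.image g).card := by
    rw [Finset.card_image_of_injective _ hg, Finset.card_univ, hcard, ← hdeg]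
    exact (Multiset.toFinset_card_le _).trans (card_roots' P)
  have heq : Finset.univ.image g = P.roots.toFinset := Finset.eq_of_subset_of_card_le hsub hcard'
  have hr' : r ∈ Finset.univ.image g := by rw [heq]; exact (hmem r).2 hr
  obtain ⟨i, -, hi⟩ := Finset.mem_image.1 hr'
  exact ⟨i, hi.symm⟩

omit [CharZero F] [Fact p.Prime] in
/-- **The roots of `X^{q_F} − X` in `k̄` are exactly `k_F`.** [cite: SerreLocalFields1979, Ch. II §4 Prop. 8] -/
theorem exists_residueFieldEmb_eq_of_pow_eq {b : ResidueField (maxUnramifiedCompletion F)}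
    (hb : b ^ residueFieldCard F = b) : ∃ x : 𝓀[F], residueFieldEmb F x = b := by
  classical
  letI := Fintype.ofFinite 𝓀[F]
  obtain ⟨x, hx⟩ := exists_eq_of_pow_eq_of_injective (one_lt_residueFieldCard F) card_residueField_eq
    (residueFieldEmb F) residueFieldEmb_injective residueFieldEmb_pow_residueFieldCard hb
  exact ⟨x, hx.symm⟩

omit [CharZero F] [Fact p.Prime] in
/-- Every `σ ∈ Γ_F` fixes every root of `X^{q_F} − X` in `k̄`. [cite: SerreLocalFields1979, Ch. II §4 Prop. 8] -/
theorem residueGal_eq_self_of_pow_eq (σ : absoluteGaloisGroup F) {b : ResidueField (maxUnramifiedCompletion F)}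
    (hb : b ^ residueFieldCard F = b) : residueGal σ b = b := by
  obtain ⟨x, rfl⟩ := exists_residueFieldEmb_eq_of_pow_eq hb
  exact residueGal_residueFieldEmb σ x

/-- `wittToC [ι x]`, `x ∈ k_F`, is a root of `X^{q_F} − X` in `ℂ_F`. [cite: SerreLocalFields1979, Ch. II §4 Prop. 8] -/
theorem wittToC_teichmuller_residueFieldEmb_pow (hp : valuation F p < 1) (x : 𝓀[F]) :
    wittToC F p hp (teichmuller p (residueFieldEmb F x)) ^ residueFieldCard F =
      wittToC F p hp (teichmuller p (residueFieldEmb F x)) := by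
  rw [← map_pow, ← map_pow, residueFieldEmb_pow_residueFieldCard]

/-! ## §3 Teichmüller lifts are separated in `ℂ_F`; the roots of `X^{q_F} − X` in `ℂ_F` -/

omit [CharZero F] [Fact p.Prime] in
/-- Units of `𝒪̂_{F^nr}` have absolute value `1` in `ℂ_F`. [cite: SerreLocalFields1979, Ch. II §5] -/
theorem norm_toC_eq_one_of_isUnit {x : maxUnramifiedCompletion F} (hx : IsUnit x) :
    ‖maxUnramifiedCompletion.toC F x‖ = 1 := by
  obtain ⟨u, rfl⟩ := hx
  have h1 : ‖maxUnramifiedCompletion.toC F (u : maxUnramifiedCompletion F)‖ ≤ 1 := norm_toC_le_one _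
  have h2 : ‖maxUnramifiedCompletion.toC F ((u⁻¹ : (maxUnramifiedCompletion F)ˣ) : maxUnramifiedCompletion F)‖ ≤ 1 :=
    norm_toC_le_one _
  have h3 : ‖maxUnramifiedCompletion.toC F (u : maxUnramifiedCompletion F)‖ *
      ‖maxUnramifiedCompletion.toC F ((u⁻¹ : (maxUnramifiedCompletion F)ˣ) : maxUnramifiedCompletion F)‖ = 1 := by
    rw [← norm_mul, ← map_mul, Units.mul_inv, map_one, norm_one]
  by_contra hne
  have hlt : ‖maxUnramifiedCompletion.toC F (u : maxUnramifiedCompletion F)‖ < 1 := lt_of_le_of_ne h1 hne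
  have : ‖maxUnramifiedCompletion.toC F (u : maxUnramifiedCompletion F)‖ *
      ‖maxUnramifiedCompletion.toC F ((u⁻¹ : (maxUnramifiedCompletion F)ˣ) : maxUnramifiedCompletion F)‖ < 1 :=
    mul_lt_one_of_nonneg_of_lt_one_left (norm_nonneg _) hlt h2
  exact absurd h3 this.ne

omit [CharZero F] [Fact p.Prime] in
/-- **An element of `𝒪̂_{F^nr}` of absolute value `< 1` in `ℂ_F` lies in `𝔪̂`.** [cite: SerreLocalFields1979, Ch. II §5] -/
theorem mem_maximalIdeal_of_norm_toC_lt_one {x : maxUnramifiedCompletion F}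
    (h : ‖maxUnramifiedCompletion.toC F x‖ < 1) : x ∈ maximalIdeal (maxUnramifiedCompletion F) :=
  (IsLocalRing.mem_maximalIdeal x).2 (mem_nonunits_iff.2 fun hu => (norm_toC_eq_one_of_isUnit hu).not_lt h)

section Instances

variable [Fact (¬ IsUnit (p : maxUnramifiedCompletion F))] [CharP (ResidueField (maxUnramifiedCompletion F)) p]
  [IsAdicComplete (Ideal.span {(p : maxUnramifiedCompletion F)}) (maxUnramifiedCompletion F)]
  [Fact (¬ IsUnit (p : integerC F))] [IsAdicComplete (Ideal.span {(p : integerC F)}) (integerC F)]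

/-- `wittToC = ι ∘ (W(k̄) → 𝒪̂_{F^nr})` (`θ ∘ 𝕎(ι♭) = ι ∘ θ_{𝒪̂}`, tree `coe_fontaineTheta_wittToAinf`).
[cite: FontaineAsterisque223III, Exp. II §1.2] -/
theorem wittToC_eq_toC_wittToCompletion (hp : valuation F p < 1) (x : WittVector p (ResidueField (maxUnramifiedCompletion F))) :
    wittToC F p hp x = maxUnramifiedCompletion.toC F (wittToCompletion F p x) := by
  rw [wittToC_apply, coe_fontaineTheta_wittToAinf]

/-- **`‖wittToC [b] − wittToC [b']‖ < 1 ⇒ b = b'`** (Teichmüller lifts with the same image modulo `𝔪_{ℂ_F}` have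
the same residue). [cite: SerreLocalFields1979, Ch. II §5 Thm. 4] -/
theorem teichmuller_eq_of_norm_wittToC_sub_lt_one (hp : valuation F p < 1) {b b' : ResidueField (maxUnramifiedCompletion F)}
    (h : ‖wittToC F p hp (teichmuller p b) - wittToC F p hp (teichmuller p b')‖ < 1) : b = b' := by
  refine teichmuller_eq_of_sub_mem_maximalIdeal (F := F) (p := p) (mem_maximalIdeal_of_norm_toC_lt_one ?_)
  rwa [map_sub, ← wittToC_eq_toC_wittToCompletion hp, ← wittToC_eq_toC_wittToCompletion hp]

/-- `b ↦ wittToC [b]` is injective on `k̄`. [cite: SerreLocalFields1979, Ch. II §5 Thm. 4] -/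
theorem wittToC_teichmuller_injective (hp : valuation F p < 1) :
    Function.Injective fun b : ResidueField (maxUnramifiedCompletion F) => wittToC F p hp (teichmuller p b) := by
  intro b b' h
  refine teichmuller_eq_of_norm_wittToC_sub_lt_one hp ?_
  have h' : wittToC F p hp (teichmuller p b) = wittToC F p hp (teichmuller p b') := h
  rw [h', sub_self, norm_zero]
  exact zero_lt_one

/-- ★ **Every root of `X^{q_F} − X` in `ℂ_F` is `wittToC [ι x]` for a unique `x ∈ k_F`** (the `q_F` such elements
are distinct roots of a polynomial of degree `q_F` over the field `ℂ_F`). [cite: SerreLocalFields1979, Ch. II §4 Prop. 8, §5 Thm. 4] -/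
theorem exists_eq_wittToC_teichmuller_of_pow_eq (hp : valuation F p < 1) {r : CompletedAlgClosure F}
    (hr : r ^ residueFieldCard F = r) : ∃ x : 𝓀[F], r = wittToC F p hp (teichmuller p (residueFieldEmb F x)) := by
  classical
  letI := Fintype.ofFinite 𝓀[F]
  exact exists_eq_of_pow_eq_of_injective (one_lt_residueFieldCard F) card_residueField_eq
    (fun x : 𝓀[F] => wittToC F p hp (teichmuller p (residueFieldEmb F x)))
    ((wittToC_teichmuller_injective hp).comp residueFieldEmb_injective)
    (wittToC_teichmuller_residueFieldEmb_pow hp) hr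

end Instances

end Literature.NumberTheory.PAdicHodge

end
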